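import Mathlib
import HarnessLib
import Summits.MatrixMultiplication.Statement
import Summits.MatrixMultiplication.MatrixMultiplication.Theses.FarEdgeDescent
import Summits.MatrixMultiplication.MatrixMultiplication.Theorems.FarEdgeDescentHostUnit
import Summits.MatrixMultiplication.MatrixMultiplication.Theorems.FarEdgeDescentTPPScreens
import Literature.Computability.AlgebraicComplexity.CohnUmansTPP
import Literature.Computability.AlgebraicComplexity.GroupAlgebraTensor
import Literature.Computability.AlgebraicComplexity.GroupAlgebraRankBounds

/-!
# FarEdgeDescent — Kernel L (lens-2 «structural dichotomy», gen 66, part 2): TPP SATURATION —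
# a named-family sufficient condition for the special crux, and its exact kill criterion

Support module (def-free, sorry-free) for the special crux `FiniteSaturation`
(stmt-MatrixMultiplication-23739, `∃ k ≥ 2, ω(1,k,1) = k + 1`) of
`Summits/MatrixMultiplication/MatrixMultiplication/Theses/FarEdgeDescent.lean`; the cut of record
`closes (h₁ : FiniteSaturation) (h₂ : AnchoredLogConvexity)` is UNCHANGED and nothing here enters it.
Part 1 (`FarEdgeDescentTPPScreens`, route-independent) holds the bookkeeping and the screens used.

Kernel XLIX-C (gen 65, `FarEdgeDescentHostUnit`) showed that every HOST-type sufficient condition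
for `h₁` read as an existence statement («∃ a (border-flat) tensor whose powers degenerate to
`⟨m, m^k, m⟩` within budget») is EQUIVALENT to `h₁` (unit domination: the unit tensor `⟨2⟩`
hosts whenever anything does), and left the finite-terms dictionary
`FiniteSaturation ⟺ ∃ k ≥ 2, ∀ ε > 0, ∃ m ≥ 2, R̲(⟨m, m^k, m⟩) ≤ m^{(k+1)(1+ε)}`
(`finiteSaturation_iff_exists_algBorderRank_le`, USED here, not restated).  The same collapse hits
the NAMED family of complex group algebras as long as the mechanism is degeneration:
`ℂ[ℤ/2]^{⊗N} = ℂ[(ℤ/2)^N]` is the unit tensor `⟨2^N⟩` in the Fourier basis, so «some `ℂ[G]`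
degenerates to the far tensor within budget» is `h₁` again.  This file types the one mechanism on
that family which does NOT collapse — the Cohn–Umans TRIPLE PRODUCT PROPERTY (a combinatorial
RESTRICTION `⟨n,m,p⟩ ≤ ℂ[G]` through subsets `S, T, U ⊆ G`; Def. 2.1 / Thm. 2.3; tree
`RealizesTPP`, `RealizesTPP.tensorRank_matMulTensor_le`) — and computes exactly what would kill it.

* §1 ★★ `finiteSaturation_of_tpp_rank` — **TPP saturation ⟹ h₁**: if for some `k ≥ 2` and every
  `ε > 0` a finite group `G` realizes `⟨m, m^k, m⟩` (`m ≥ 2`) through the TPP with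
  `R(ℂ[G]) ≤ m^{(k+1)(1+ε)}`, then `FiniteSaturation`; ★★ `finiteSaturation_of_tpp_cubes` — the
  same with the Wedderburn budget `∑_χ χ(1)³ ≤ m^{(k+1)(1+ε)}` (`R(ℂ[G]) ≤ ∑ᵢ R(⟨dᵢ,dᵢ,dᵢ⟩) ≤ ∑ᵢ dᵢ³`,
  HHMM 2013 §1.4); ★ `finiteSaturation_of_tpp_maxDegree` — with the Cor. 1.9-type budget
  `d_max(G)·|G| ≤ m^{(k+1)(1+ε)}`.  Route: `R̲(⟨m,m^k,m⟩) ≤ R(⟨m,m^k,m⟩) ≤ R(ℂ[G])` (Cohn–Umans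
  Thm. 2.3 in rank form) and the ★★★★ dictionary.
* §3 the exact KILL CRITERION: ★★ `not_tppSaturation_of_packing_le_meanDegree_rpow` — any
  inequality `n·m·p ≤ C·|G|·c(G)^R` (`c(G) = (∑χ(1)³)/|G|`, the Plancherel-mean character degree;
  constants `C`, `R ≥ 0`) valid for all TPP triples of all finite groups refutes TPP saturation
  (cubes budget) at EVERY exponent `k`: by part 1 a witness at tolerance `ε` has
  `a^{k+1} < |G| ≤ ∑χ(1)³ ≤ a^{(k+1)(1+ε)}`, so it packs a factor `a^{1-(k+1)ε}` ABOVE `|G|` with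
  mean degree `≤ a^{(k+1)ε}`; ★ `not_tppSaturation_of_abelianIndex_le_meanDegree_rpow` — so does a
  Plancherel-averaged Isaacs–Passman bound `v_ab(G) ≤ C·c(G)^R` (through Neumann's
  `n·m·p ≤ v_ab²|G|`, part 1).  The bounds in print control `v_ab` by the LARGEST degree `b(G)`
  (`v_ab ≤ (b!)²`, Isaacs 1976 Thm. 12.23; `≤ b⁸`, Cossey–Halasi–Maróti–Nguyen 2015 Thm. 8), which
  the budget does not make small (`b ≤ a^{(k+1)(1+ε)/3}` only); the averaged forms are not in
  print.  So TPP saturation is UNDECIDED, and its decision is a question about finite groups alone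
  (Cohn–Umans ask the square-shape prototype as Question 4.1: `nmp > ∑ dᵢ³`? — answered «yes» by
  CKSU 2005; saturation asks `nmp ≥ (∑ dᵢ³)^{(k+2)/((k+1)(1+ε))}` at the skinny shape).
Positioning (critic g23 ruling (1) for g66, STATUS l.3289): for the named family `{ℂ[G]}`, «a
FIXED group algebra and its tensor powers host `(1,k,1)` exactly» is REFUTED (part 1, strict
packing), «SOME group algebra degenerates to the far tensor within budget» is `h₁` itself (unit
domination), and TPP SATURATION (§1) sits strictly between the two in logical form: implied by the
(empty) fixed-power version, implying `h₁`, not reachable from `h₁` by the unit route (abelian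
witnesses excluded).  Whether it is strictly stronger than `h₁` is open; §3 says exactly which
representation-theoretic inequality would refute it outright.  Nothing here proves `ω = 2` or the
crux; no definitions (gate rule D-0009).

[cite: CohnUmans2003, Def. 2.1, Thm. 2.3, Lemma 3.1, Thm. 4.1, Question 4.1]
[cite: CohnKleinbergSzegedyUmans2005, Def. 1.3, Thm. 1.8, Cor. 1.9]
[cite: HartEtAl2013, §1.4, Thm. 3.1] [cite: Neumann2011, Obs. 4.1, Cor. 4.2]
[cite: Isaacs1976, Thm. 12.23] [cite: CosseyHalasiMarotiNguyen2015, Thm. 8]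
Written by the decomp-mm lens-2 planner seat (gen 66); imports only BUILT modules.
-/

namespace Summit.MatrixMultiplication.MatrixMultiplication.Theorems.FarEdgeDescentTPPSaturation

open Literature.Computability.AlgebraicComplexity
open Literature.RepresentationTheory.FiniteGroups
open Summit.MatrixMultiplication.MatrixMultiplication.Theses.FarEdgeDescent
open Summit.MatrixMultiplication.MatrixMultiplication.Theorems.FarEdgeDescentHostUnit
open Summit.MatrixMultiplication.MatrixMultiplication.Theorems.FarEdgeDescentTPPScreens

/-! ## §1 TPP saturation ⟹ `FiniteSaturation` -/

/-- ★★ **TPP saturation, rank budget, implies the special crux.**  If for some `k ≥ 2` and every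
tolerance `ε > 0` some finite group realizes `⟨m, m^k, m⟩` (`m ≥ 2`) through the triple product
property with `R(ℂ[G]) ≤ m^{(k+1)(1+ε)}`, then `ω(1,k,1) = k + 1` for that `k`:
`R̲(⟨m,m^k,m⟩) ≤ R(⟨m,m^k,m⟩) ≤ R(ℂ[G])` (Cohn–Umans 2003, Thm. 2.3) and the finite-terms
dictionary `finiteSaturation_iff_exists_algBorderRank_le`. [cite: CohnUmans2003, Thm. 2.3]
[cite: HartEtAl2013, §1.4] -/
theorem finiteSaturation_of_tpp_rank {k : ℕ} (hk : 2 ≤ k)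
    (h : ∀ ε : ℝ, 0 < ε → ∃ (G : Type) (_ : Group G) (_ : Fintype G) (_ : DecidableEq G) (m : ℕ),
      2 ≤ m ∧ RealizesTPP G m (m ^ k) m ∧
        (tensorRank (groupTensor ℂ G) : ℝ) ≤ (m : ℝ) ^ (((k : ℝ) + 1) * (1 + ε))) :
    FiniteSaturation := by
  refine finiteSaturation_iff_exists_algBorderRank_le.mpr ⟨k, hk, fun ε hε => ?_⟩
  obtain ⟨G, _, _, _, m, hm, htpp, hR⟩ := h ε hε
  refine ⟨m, hm, le_trans ?_ hR⟩
  exact_mod_cast (algBorderRank_le_tensorRank _).trans (htpp.tensorRank_matMulTensor_le ℂ)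

/-- ★★ **TPP saturation, Wedderburn budget**: the same with `∑_χ χ(1)^3 ≤ m^{(k+1)(1+ε)}` in place of
`R(ℂ[G])` (`R(ℂ[G]) ≤ ∑ᵢ dᵢ³`).  This is the form in which candidate families are screened: the
data are `|S|, |T|, |U|` and the character degrees. [cite: CohnKleinbergSzegedyUmans2005, Thm. 1.8]
[cite: HartEtAl2013, §1.4] -/
theorem finiteSaturation_of_tpp_cubes {k : ℕ} (hk : 2 ≤ k)
    (h : ∀ ε : ℝ, 0 < ε → ∃ (G : Type) (_ : Group G) (_ : Fintype G) (_ : DecidableEq G) (m : ℕ),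
      2 ≤ m ∧ RealizesTPP G m (m ^ k) m ∧
        charDegreePowSum G 3 ≤ (m : ℝ) ^ (((k : ℝ) + 1) * (1 + ε))) :
    FiniteSaturation := by
  refine finiteSaturation_of_tpp_rank hk fun ε hε => ?_
  obtain ⟨G, _, _, _, m, hm, htpp, hR⟩ := h ε hε
  exact ⟨G, inferInstance, inferInstance, inferInstance, m, hm, htpp,
    (tensorRank_groupTensor_le_charDegreePowSum_three G).trans hR⟩

/-- ★ **TPP saturation, largest-degree budget**: the same with `d_max(G) · |G| ≤ m^{(k+1)(1+ε)}`
(the Cor. 1.9 shape). [cite: CohnKleinbergSzegedyUmans2005, Cor. 1.9] -/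
theorem finiteSaturation_of_tpp_maxDegree {k : ℕ} (hk : 2 ≤ k)
    (h : ∀ ε : ℝ, 0 < ε → ∃ (G : Type) (_ : Group G) (_ : Fintype G) (_ : DecidableEq G) (m : ℕ),
      2 ≤ m ∧ RealizesTPP G m (m ^ k) m ∧
        (maxCharDegree G : ℝ) * Fintype.card G ≤ (m : ℝ) ^ (((k : ℝ) + 1) * (1 + ε))) :
    FiniteSaturation := by
  refine finiteSaturation_of_tpp_cubes hk fun ε hε => ?_
  obtain ⟨G, _, _, _, m, hm, htpp, hR⟩ := h ε hε
  exact ⟨G, inferInstance, inferInstance, inferInstance, m, hm, htpp,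
    (charDegreePowSum_three_le_maxCharDegree_mul_card G).trans hR⟩

/-! ## §3 Conditional exclusion: TPP capacity versus the Plancherel-mean character degree

Write `c(G) := (∑_χ χ(1)³)/|G|` — the mean character degree under Plancherel measure
`χ(1)²/|G|` (`c(G) ≥ 1`, with equality iff `G` is abelian).  A witness of TPP saturation at
exponent `k` and tolerance `ε` has (§0–§2) `a^{k+1} < |G| ≤ ∑ χ(1)³ ≤ a^{(k+1)(1+ε)}`, hence
`c(G) ≤ a^{(k+1)ε}` while its TPP ratio is `a^{k+2}/|G| ≥ a^{1-(k+1)ε}`: the family must pack a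
factor `a^{1-o(1)}` ABOVE `|G|` with Plancherel-mean degree `a^{o(1)}`.  The theorem below makes the
resulting kill criterion exact: ANY inequality `n·m·p ≤ C·|G|·c(G)^R` valid for all TPP triples of
all finite groups (constants `C`, `R ≥ 0`) refutes TPP saturation at every exponent.  By §2
(Neumann's `n·m·p ≤ v²|G|`) such an inequality follows from a Plancherel-averaged Isaacs–Passman
bound `v_ab(G) ≤ C' c(G)^{R/2}` (least index of an abelian subgroup); the bounds in print control
`v_ab` by the MAXIMAL degree only (`v_ab ≤ (b!)²`, Isaacs 1976 Thm. 12.23; `≤ b⁸`,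
Cossey–Halasi–Maróti–Nguyen Thm. 8), which the budget does not make small. -/

/-- ★★ **Conditional kill: a packing-versus-mean-degree inequality refutes TPP saturation at every
exponent.**  If for some constants `C` and `R ≥ 0` every finite group `G` realizing `⟨n, m, p⟩`
through the TPP satisfies `n·m·p ≤ C · |G| · ((∑_χ χ(1)³)/|G|)^R`, then for NO `k` does the
hypothesis of `finiteSaturation_of_tpp_cubes` hold: choosing
`ε = min (1/(2(k+1)(1+R))) (1/(2X₀²))` with `X₀ = max(C,1)^{2(k+1)}`, a witness `(G, a)` would have
`a ≤ max(C,1)²` (from the inequality, `|G| ≤ a^{(k+1)(1+ε)}` and `|G| > a^{k+1}`), hence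
`x := a^{k+1} ≤ X₀`, while strict packing in `ℕ` gives `x + 1 ≤ |G| ≤ x · x^ε ≤ x (1 + ε(X₀ - 1))`
(Bernoulli), i.e. `1/X₀ ≤ 1/x ≤ ε X₀ ≤ 1/(2X₀)` — absurd.
[cite: Neumann2011, Cor. 4.2] [cite: Isaacs1976, Thm. 12.23]
[cite: CosseyHalasiMarotiNguyen2015, Thm. 8] [cite: CohnUmans2003, Question 4.1] -/
theorem not_tppSaturation_of_packing_le_meanDegree_rpow {C R : ℝ} (hR : 0 ≤ R)
    (hP : ∀ (G : Type) [Group G] [Fintype G] [DecidableEq G] (n m p : ℕ), RealizesTPP G n m p →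
      ((n * m * p : ℕ) : ℝ) ≤
        C * Fintype.card G * (charDegreePowSum G 3 / Fintype.card G) ^ R)
    (k : ℕ) :
    ¬ (∀ ε : ℝ, 0 < ε → ∃ (G : Type) (_ : Group G) (_ : Fintype G) (_ : DecidableEq G) (a : ℕ),
        2 ≤ a ∧ RealizesTPP G a (a ^ k) a ∧
          charDegreePowSum G 3 ≤ (a : ℝ) ^ (((k : ℝ) + 1) * (1 + ε))) := by
  intro h
  -- constants: `C₁ = max C 1`, `X₀ = C₁^{2(k+1)}`, `κ = k+1`, `ε = min (1/(2κ(1+R))) (1/(2X₀²))`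
  set C₁ : ℝ := max C 1 with hC₁def
  have hC₁ : 1 ≤ C₁ := le_max_right _ _
  have hCC₁ : C ≤ C₁ := le_max_left _ _
  have hC₁0 : 0 ≤ C₁ := zero_le_one.trans hC₁
  set X₀ : ℝ := C₁ ^ (2 * (k + 1)) with hX₀def
  have hX₀ : 1 ≤ X₀ := one_le_pow₀ hC₁
  have hX₀pos : 0 < X₀ := zero_lt_one.trans_le hX₀
  set κ : ℝ := (k : ℝ) + 1 with hκdef
  have hκpos : 0 < κ := by positivity
  have h2κ : 0 < 2 * κ * (1 + R) := by positivity
  have h2X : 0 < 2 * X₀ ^ 2 := by positivity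
  set ε : ℝ := min (1 / (2 * κ * (1 + R))) (1 / (2 * X₀ ^ 2)) with hεdef
  have hε : 0 < ε := lt_min (by positivity) (by positivity)
  have hε1 : ε ≤ 1 / (2 * κ * (1 + R)) := min_le_left _ _
  have hε2 : ε ≤ 1 / (2 * X₀ ^ 2) := min_le_right _ _
  have hεone : ε ≤ 1 := by
    refine hε2.trans ?_
    rw [div_le_one h2X]
    nlinarith [hX₀]
  -- the witness at tolerance `ε`
  obtain ⟨G, _iG, _iF, _iD, a, ha, htpp, hcub⟩ := h ε hε
  have ha1 : (1 : ℝ) < a := by exact_mod_cast ha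
  have ha0 : (0 : ℝ) < a := zero_lt_one.trans ha1
  have hGpos : (0 : ℝ) < Fintype.card G := by exact_mod_cast Fintype.card_pos
  -- (F1) strict packing in `ℕ`, (F2) `|G| ≤ ∑ χ(1)³ ≤ Λ := a^{κ(1+ε)}`
  have hpack : a ^ (k + 1) < Fintype.card G := (pow_succ_lt_tensorRank_of_tpp ha htpp).1
  have hGcub : (Fintype.card G : ℝ) ≤ charDegreePowSum G 3 :=
    le_trans (by exact_mod_cast card_le_tensorRank_groupTensor G)
      (tensorRank_groupTensor_le_charDegreePowSum_three G)
  set x : ℝ := (a : ℝ) ^ (k + 1) with hxdef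
  have hxκ : x = (a : ℝ) ^ κ := by
    rw [hxdef, hκdef, show (k : ℝ) + 1 = ((k + 1 : ℕ) : ℝ) by push_cast; ring, Real.rpow_natCast]
  have hx1 : (1 : ℝ) ≤ x := one_le_pow₀ ha1.le
  have hxpos : 0 < x := zero_lt_one.trans_le hx1
  have hxG : x + 1 ≤ Fintype.card G := by
    have h' : a ^ (k + 1) + 1 ≤ Fintype.card G := hpack
    have h'' : ((a ^ (k + 1) + 1 : ℕ) : ℝ) ≤ Fintype.card G := by exact_mod_cast h'
    simpa [hxdef] using h''
  set y : ℝ := (a : ℝ) ^ (κ * ε) with hydef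
  have hypos : 0 < y := Real.rpow_pos_of_pos ha0 _
  have hy1 : 1 ≤ y := Real.one_le_rpow ha1.le (by positivity)
  have hΛsplit : (a : ℝ) ^ (((k : ℝ) + 1) * (1 + ε)) = x * y := by
    rw [hxκ, hydef, ← Real.rpow_add ha0, ← hκdef]
    ring_nf
  -- (F3) the packing-vs-mean-degree inequality at the witness: `x·a ≤ C₁ · (x·y) · y^R`
  have hratio0 : 0 ≤ charDegreePowSum G 3 / Fintype.card G :=
    div_nonneg (hGpos.le.trans hGcub) hGpos.le
  have hratio : charDegreePowSum G 3 / Fintype.card G ≤ y := by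
    rw [div_le_iff₀ hGpos]
    calc charDegreePowSum G 3 ≤ x * y := hΛsplit ▸ hcub
      _ = y * x := mul_comm _ _
      _ ≤ y * Fintype.card G := mul_le_mul_of_nonneg_left (by linarith) hypos.le
  have hpowR : (charDegreePowSum G 3 / Fintype.card G) ^ R ≤ y ^ R :=
    Real.rpow_le_rpow hratio0 hratio hR
  have hnmp : ((a * a ^ k * a : ℕ) : ℝ) = x * a := by
    push_cast
    rw [hxdef]
    ring
  have hmain : x * a ≤ x * (C₁ * (y * y ^ R)) := by
    calc x * a = ((a * a ^ k * a : ℕ) : ℝ) := hnmp.symm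
      _ ≤ C * Fintype.card G * (charDegreePowSum G 3 / Fintype.card G) ^ R := hP G a (a ^ k) a htpp
      _ ≤ C₁ * Fintype.card G * (charDegreePowSum G 3 / Fintype.card G) ^ R :=
          mul_le_mul_of_nonneg_right (mul_le_mul_of_nonneg_right hCC₁ hGpos.le)
            (Real.rpow_nonneg hratio0 R)
      _ ≤ C₁ * (x * y) * y ^ R := by
          apply mul_le_mul _ hpowR (Real.rpow_nonneg hratio0 R) (by positivity)
          exact mul_le_mul_of_nonneg_left (hGcub.trans (hΛsplit ▸ hcub)) hC₁0
      _ = x * (C₁ * (y * y ^ R)) := by ring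
  have ha_le : (a : ℝ) ≤ C₁ * (y * y ^ R) := le_of_mul_le_mul_left hmain hxpos
  -- `y · y^R = a^{κ ε (1+R)} ≤ a^{1/2}`
  have hyR : y * y ^ R = (a : ℝ) ^ (κ * ε * (1 + R)) := by
    rw [hydef, ← Real.rpow_mul ha0.le, ← Real.rpow_add ha0]
    ring_nf
  have hexp : κ * ε * (1 + R) ≤ 1 / 2 := by
    calc κ * ε * (1 + R) = (ε * (2 * κ * (1 + R))) / 2 := by ring
      _ ≤ ((1 / (2 * κ * (1 + R))) * (2 * κ * (1 + R))) / 2 := by gcongr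
      _ = 1 / 2 := by rw [one_div_mul_cancel h2κ.ne']
  have hsqrt : y * y ^ R ≤ (a : ℝ) ^ (1 / 2 : ℝ) := by
    rw [hyR]
    exact Real.rpow_le_rpow_of_exponent_le ha1.le hexp
  have hroot_pos : 0 < (a : ℝ) ^ (1 / 2 : ℝ) := Real.rpow_pos_of_pos ha0 _
  have hroot_sq : ((a : ℝ) ^ (1 / 2 : ℝ)) ^ 2 = a := by
    rw [← Real.rpow_natCast, ← Real.rpow_mul ha0.le]
    norm_num
  -- hence `a^{1/2} ≤ C₁`, `a ≤ C₁²`, `x ≤ X₀`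
  have hroot_le : (a : ℝ) ^ (1 / 2 : ℝ) ≤ C₁ := by
    have h1 : (a : ℝ) ^ (1 / 2 : ℝ) * (a : ℝ) ^ (1 / 2 : ℝ) ≤ C₁ * (a : ℝ) ^ (1 / 2 : ℝ) := by
      calc (a : ℝ) ^ (1 / 2 : ℝ) * (a : ℝ) ^ (1 / 2 : ℝ) = a := by rw [← sq, hroot_sq]
        _ ≤ C₁ * (y * y ^ R) := ha_le
        _ ≤ C₁ * (a : ℝ) ^ (1 / 2 : ℝ) := mul_le_mul_of_nonneg_left hsqrt hC₁0
    exact le_of_mul_le_mul_right h1 hroot_pos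
  have ha_C : (a : ℝ) ≤ C₁ ^ 2 := by
    rw [← hroot_sq]
    exact pow_le_pow_left₀ hroot_pos.le hroot_le 2
  have hxX : x ≤ X₀ := by
    rw [hxdef, hX₀def, pow_mul]
    exact pow_le_pow_left₀ ha0.le ha_C (k + 1)
  -- (F5) the integer gap: `x + 1 ≤ |G| ≤ x·y`, `y = x^ε ≤ X₀^ε ≤ 1 + ε (X₀ - 1)`
  have hyx : y = x ^ ε := by rw [hydef, hxκ, ← Real.rpow_mul ha0.le]
  have hyB : y ≤ 1 + ε * (X₀ - 1) := by
    calc y = x ^ ε := hyx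
      _ ≤ X₀ ^ ε := Real.rpow_le_rpow hxpos.le hxX hε.le
      _ = (1 + (X₀ - 1)) ^ ε := by ring_nf
      _ ≤ 1 + ε * (X₀ - 1) := rpow_one_add_le_one_add_mul_self (by linarith) hε.le hεone
  have hgap : x + 1 ≤ x * y :=
    hxG.trans (hGcub.trans (hΛsplit ▸ hcub))
  -- `1/X₀ ≤ 1/x ≤ ε (X₀ - 1) ≤ ε X₀ ≤ 1/(2 X₀)`: contradiction
  have hxy : x * y ≤ x * (1 + ε * (X₀ - 1)) := mul_le_mul_of_nonneg_left hyB hxpos.le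
  have hinv : 1 ≤ x * (ε * (X₀ - 1)) := by linarith [hgap, hxy]
  have he1 : x * (ε * (X₀ - 1)) ≤ x * (ε * X₀) :=
    mul_le_mul_of_nonneg_left (mul_le_mul_of_nonneg_left (by linarith) hε.le) hxpos.le
  have he2 : x * (ε * X₀) ≤ X₀ * (ε * X₀) := mul_le_mul_of_nonneg_right hxX (by positivity)
  have hinv' : 1 ≤ X₀ * (ε * X₀) := hinv.trans (he1.trans he2)
  have hεX : ε * X₀ ≤ 1 / (2 * X₀) := by
    calc ε * X₀ ≤ (1 / (2 * X₀ ^ 2)) * X₀ := mul_le_mul_of_nonneg_right hε2 hX₀pos.le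
      _ = 1 / (2 * X₀) := by
          rw [pow_two, ← mul_assoc, div_mul_eq_mul_div, one_mul, div_mul_cancel_right₀ hX₀pos.ne',
            one_div]
  have hfin : (1 : ℝ) ≤ X₀ * (1 / (2 * X₀)) :=
    hinv'.trans (mul_le_mul_of_nonneg_left hεX hX₀pos.le)
  rw [mul_one_div, div_mul_cancel_right₀ hX₀pos.ne'] at hfin
  norm_num at hfin

/-- ★ **The Plancherel-averaged Isaacs–Passman form of the kill.**  If every finite group has an
abelian subgroup of index at most `C · c(G)^R` (`c(G) = (∑ χ(1)³)/|G|`, constants `C`, `R ≥ 0`),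
then — through Neumann's index bound `n·m·p ≤ v²|G|` (§2) — TPP saturation fails at every exponent.
(In print: `v_ab(G) ≤ (b(G)!)²` and `≤ b(G)⁸` with `b` the LARGEST degree; the averaged form is
open.) [cite: Isaacs1976, Thm. 12.23] [cite: CosseyHalasiMarotiNguyen2015, Thm. 8]
[cite: Neumann2011, Cor. 4.2] -/
theorem not_tppSaturation_of_abelianIndex_le_meanDegree_rpow {C R : ℝ} (hR : 0 ≤ R)
    (hIP : ∀ (G : Type) [Group G] [Fintype G] [DecidableEq G], ∃ B : Subgroup G,
      (∀ x ∈ B, ∀ y ∈ B, x * y = y * x) ∧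
        (B.index : ℝ) ≤ C * (charDegreePowSum G 3 / Fintype.card G) ^ R)
    (k : ℕ) :
    ¬ (∀ ε : ℝ, 0 < ε → ∃ (G : Type) (_ : Group G) (_ : Fintype G) (_ : DecidableEq G) (a : ℕ),
        2 ≤ a ∧ RealizesTPP G a (a ^ k) a ∧
          charDegreePowSum G 3 ≤ (a : ℝ) ^ (((k : ℝ) + 1) * (1 + ε))) := by
  refine not_tppSaturation_of_packing_le_meanDegree_rpow (C := C ^ 2) (R := 2 * R)
    (by positivity) (fun G _ _ _ n m p htpp => ?_) k
  obtain ⟨B, hB, hidx⟩ := hIP G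
  have hGpos : (0 : ℝ) < Fintype.card G := by exact_mod_cast Fintype.card_pos
  have hGcub : (Fintype.card G : ℝ) ≤ charDegreePowSum G 3 :=
    le_trans (by exact_mod_cast card_le_tensorRank_groupTensor G)
      (tensorRank_groupTensor_le_charDegreePowSum_three G)
  have hratio0 : 0 ≤ charDegreePowSum G 3 / Fintype.card G :=
    div_nonneg (hGpos.le.trans hGcub) hGpos.le
  have h1 : ((n * m * p : ℕ) : ℝ) ≤ (B.index : ℝ) ^ 2 * Fintype.card G := by
    exact_mod_cast tpp_mul_mul_le_index_sq_mul_card htpp B hB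
  have h2 : (B.index : ℝ) ^ 2 ≤ (C * (charDegreePowSum G 3 / Fintype.card G) ^ R) ^ 2 :=
    pow_le_pow_left₀ (by positivity) hidx 2
  calc ((n * m * p : ℕ) : ℝ) ≤ (B.index : ℝ) ^ 2 * Fintype.card G := h1
    _ ≤ (C * (charDegreePowSum G 3 / Fintype.card G) ^ R) ^ 2 * Fintype.card G :=
        mul_le_mul_of_nonneg_right h2 hGpos.le
    _ = C ^ 2 * Fintype.card G * (charDegreePowSum G 3 / Fintype.card G) ^ (2 * R) := by
        rw [mul_pow, ← Real.rpow_natCast ((charDegreePowSum G 3 / Fintype.card G) ^ R) 2,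
          ← Real.rpow_mul hratio0, show R * ((2 : ℕ) : ℝ) = 2 * R by push_cast; ring]
        ring

end Summit.MatrixMultiplication.MatrixMultiplication.Theorems.FarEdgeDescentTPPSaturation
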